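import Literature.Analysis.FluidPDE.AxisymOmegaThetaEnergy
import Literature.Analysis.FluidPDE.TaoClassQuotientBalance
import Literature.Analysis.FluidPDE.ParticleTrajectoryFlowEstimates
import HarnessLib

/-!
# Lei–Zhang 2017, §3: `ω^θ ∈ L^∞L²` a priori, in Tao's class (Grönwall with a forcing majorant)

Analysis/FluidPDE proof file (theorems only; no definitions, no named facts) on the discharge path
of the named fact `Literature.Analysis.FluidPDE.LeiZhang2017_logModulus_regularity`
(Lei–Zhang 2017, arXiv:1505.02628, Cor. 1.3). §3, p. 9:

> "`½ d/dt‖ω^θ‖² + ‖∇ω^θ‖² + ‖ω^θ/r‖² ≤ 4‖ω^θ‖‖∇ω^θ‖‖vʳ/r‖_∞ + ‖∇ω^θ‖‖(v^θ)²/r‖`,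
> one can easily derive that `ω^θ ∈ L^∞L²`."

The tree's fixed-time inequality `IsTaoSolutionOn.omegaTheta_slice_le`
(`2∫r²ΩΩ' ≤ 2W_∞∫r²Ω² + ∫r²Φ⁴`, `AxisymOmegaThetaEnergy`) is combined here with the `L²` balance of
`ω^θ = rΩ` (`IsTaoSolutionOn.integral_sq_eq_of_repr` of `TaoClassQuotientBalance`, representation
`rΩ = r⁻²⟪rJx, ω⟫` off the axis), an integrable majorant `β ≥ 0` of `‖vʳ/r(t)‖_∞` and an integrable
majorant `Pm ≥ 0` of the forcing `∫ r²Φ(t)⁴ = ‖(v^θ)²/r‖²` on `(0, T)` (both supplied, in the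
log-modulus setting, by `LeiZhang2017E8` and `LeiZhang2017SwirlL4Apriori`); Grönwall
(`real_gronwall_Icc`) then gives

* `IsTaoSolutionOn.omegaTheta_balance'` — `∫ r²Ω(b)² = ∫ r²Ω(0)² + 2∫_{(0,b)}∫ r²ΩΩ'`, with the
  integrability of the pairing and a uniform bound of `∫ r²Ω(t)²`;
* `IsTaoSolutionOn.omegaTheta_apriori` — for `b ∈ [0, T]`,
  `∫ r²Ω(b)² ≤ (∫ r²Ω(0)² + ∫₀ᵀ Pm) · exp (2∫₀ᵀ β)`.

## References

* Z. Lei, Q. S. Zhang, Pacific J. Math. 289 (2017) 169–187, arXiv:1505.02628, §3, p. 9. [`LeiZhang2017`]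
* A. J. Majda, A. L. Bertozzi, Vorticity and incompressible flow, CUP 2002, Lemma 4.7 (Grönwall). [folklore]
-/

noncomputable section

open MeasureTheory Set Function Filter Topology InnerProductSpace WithLp
open scoped RealInnerProductSpace ContDiff ENNReal NNReal Topology

namespace Literature.Analysis.FluidPDE

section OmegaTheta

variable {T ν : ℝ} {u₀ : EuclideanSpace ℝ (Fin 3) → EuclideanSpace ℝ (Fin 3)}
  {v : ℝ → EuclideanSpace ℝ (Fin 3) → EuclideanSpace ℝ (Fin 3)} {q : ℝ → EuclideanSpace ℝ (Fin 3) → ℝ}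

/-- `∫ f ≤ (∫⁻ ofReal g).toReal` for an integrable `f ≤ g` a.e., `g ≥ 0` a.e., with
`∫⁻ ofReal g < ∞` (no measurability of `g` needed). [folklore] -/
private theorem integral_le_toReal_lintegral_of_le' {α : Type*} [MeasurableSpace α] {μ : Measure α}
    {f g : α → ℝ} (hf : Integrable f μ) (hg : ∀ᵐ a ∂μ, 0 ≤ g a) (hfg : ∀ᵐ a ∂μ, f a ≤ g a)
    (hfin : ∫⁻ a, ENNReal.ofReal (g a) ∂μ ≠ ⊤) :
    ∫ a, f a ∂μ ≤ (∫⁻ a, ENNReal.ofReal (g a) ∂μ).toReal := by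
  calc ∫ a, f a ∂μ ≤ ∫ a, max (f a) 0 ∂μ := integral_mono hf hf.pos_part fun a => le_max_left _ _
    _ = (∫⁻ a, ENNReal.ofReal (max (f a) 0) ∂μ).toReal :=
        integral_eq_lintegral_of_nonneg_ae (Eventually.of_forall fun a => le_max_right _ _)
          hf.pos_part.aestronglyMeasurable
    _ ≤ (∫⁻ a, ENNReal.ofReal (g a) ∂μ).toReal := by
        refine ENNReal.toReal_mono hfin (lintegral_mono_ae ?_)
        filter_upwards [hg, hfg] with a ha hfa
        exact ENNReal.ofReal_le_ofReal (max_le hfa ha)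

/-- **The `L²` balance of `ω^θ = rΩ`** along a Tao-class solution with axisymmetric slices:
`t ↦ ∫ r²ΩΩ'` is integrable on `(0, T)`, `∫ r²Ω(t)² ≤ C` uniformly on `[0, T]` for some `C`, and
`∫ r²Ω(b)² = ∫ r²Ω(0)² + 2∫_{(0,b)} ∫ r²ΩΩ'` for `b ∈ (0, T]` (`Ω' = angVortQuot (∂ₜv)`).
[cite: LeiZhang2017, §3, p. 9] -/
theorem IsTaoSolutionOn.omegaTheta_balance' (h : IsTaoSolutionOn T ν u₀ v q) (hT : 0 < T)
    (hax : ∀ t ∈ Icc 0 T, IsAxisymmetric (v t)) :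
    IntegrableOn (fun t => ∫ x : EuclideanSpace ℝ (Fin 3), (x 0 ^ 2 + x 1 ^ 2) * angVortQuot (v t) x *
      angVortQuot (timeDerivWithin (Icc 0 T) v t) x) (Ioo 0 T) ∧
    (∃ C : ℝ, ∀ t ∈ Icc 0 T, ∫ x : EuclideanSpace ℝ (Fin 3), (x 0 ^ 2 + x 1 ^ 2) * angVortQuot (v t) x ^ 2 ≤ C) ∧
    ∀ b ∈ Ioc 0 T, ∫ x : EuclideanSpace ℝ (Fin 3), (x 0 ^ 2 + x 1 ^ 2) * angVortQuot (v b) x ^ 2 =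
      (∫ x : EuclideanSpace ℝ (Fin 3), (x 0 ^ 2 + x 1 ^ 2) * angVortQuot (v 0) x ^ 2) +
        2 * ∫ t in Ioo 0 b, ∫ x : EuclideanSpace ℝ (Fin 3), (x 0 ^ 2 + x 1 ^ 2) * angVortQuot (v t) x *
          angVortQuot (timeDerivWithin (Icc 0 T) v t) x := by
  have hU : UniqueDiffOn ℝ (Icc 0 T) := uniqueDiffOn_Icc hT
  have hsm : IsSmoothSpaceTimeOn (Icc 0 T) v := h.classical.smooth_velocity
  set w := timeDerivWithin (Icc 0 T) v with hw
  have hvs : ∀ t ∈ Icc 0 T, ContDiff ℝ ∞ (v t) := fun t ht => h.classical.contDiff_velocity ht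
  have hws : ∀ t ∈ Icc 0 T, ContDiff ℝ ∞ (w t) := fun t ht => hsm.contDiff_timeDerivWithin_slice hU ht
  have hwax : ∀ t ∈ Icc 0 T, IsAxisymmetric (w t) := fun t ht => hsm.isAxisymmetric_timeDerivWithin hax ht
  -- the functions `g = rΩ`, `g' = rΩ'`
  set g : ℝ → EuclideanSpace ℝ (Fin 3) → ℝ := fun t x => cylRadius x * angVortQuot (v t) x with hg
  set g' : ℝ → EuclideanSpace ℝ (Fin 3) → ℝ := fun t x => cylRadius x * angVortQuot (w t) x with hg'
  set a : EuclideanSpace ℝ (Fin 3) → EuclideanSpace ℝ (Fin 3) := fun x => cylRadius x • rotGen x with ha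
  have hac : Continuous a := continuous_cylRadius.smul rotGenL.continuous
  -- representation off the axis
  have hrep : ∀ {u : EuclideanSpace ℝ (Fin 3) → EuclideanSpace ℝ (Fin 3)}, IsAxisymmetric u → ContDiff ℝ 3 u →
      ∀ x, cylRadius x ≠ 0 → cylRadius x * angVortQuot u x = (cylRadius x ^ 2)⁻¹ * ⟪a x, curl u x⟫ := by
    intro u hu hu3 x hx
    have e := hu.cylRadius_sq_mul_angVortQuot hu3 x
    rw [swirl_eq_inner_rotGen] at e
    simp only at e
    simp only [ha, real_inner_smul_left]
    rw [← e]
    field_simp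
  -- uniform `L²` bounds
  obtain ⟨C₁, hC₁⟩ := hasBoundedSobolevNormsOn_curl h.sobolev hvs 0
  obtain ⟨C₂, hC₂⟩ := hasBoundedSobolevNormsOn_curl h.sobolev_dt hws 0
  have e0 : ∀ (f : EuclideanSpace ℝ (Fin 3) → EuclideanSpace ℝ (Fin 3)),
      ∫⁻ x, ‖f x‖ₑ ^ 2 = ∫⁻ x, ‖iteratedFDeriv ℝ 0 f x‖ₑ ^ 2 :=
    fun f => lintegral_congr fun x => by rw [← ofReal_norm, ← ofReal_norm, norm_iteratedFDeriv_zero]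
  have hpt : ∀ {u : EuclideanSpace ℝ (Fin 3) → EuclideanSpace ℝ (Fin 3)}, IsAxisymmetric u → ContDiff ℝ 3 u →
      ∀ x, ‖cylRadius x * angVortQuot u x‖ₑ ^ 2 ≤ ‖curl u x‖ₑ ^ 2 := by
    intro u hu hu3 x
    have h1 := hu.cylRadius_mul_abs_angVortQuot_le hu3 x
    rw [← ofReal_norm, ← ofReal_norm, ← ENNReal.ofReal_pow (norm_nonneg _), ← ENNReal.ofReal_pow (norm_nonneg _)]
    refine ENNReal.ofReal_le_ofReal (pow_le_pow_left₀ (norm_nonneg _) ?_ 2)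
    rw [Real.norm_eq_abs, abs_mul, abs_of_nonneg (cylRadius_nonneg x)]
    exact h1
  have hgb : ∀ t ∈ Icc 0 T, ∫⁻ x, ‖g t x‖ₑ ^ 2 ≤ C₁ := fun t ht => by
    refine (lintegral_mono fun x => hpt (hax t ht) ((hvs t ht).of_le (by norm_cast)) x).trans ?_
    rw [e0]; exact hC₁ t ht
  have hg'b : ∀ t ∈ Icc 0 T, ∫⁻ x, ‖g' t x‖ₑ ^ 2 ≤ C₂ := fun t ht => by
    refine (lintegral_mono fun x => hpt (hwax t ht) ((hws t ht).of_le (by norm_cast)) x).trans ?_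
    rw [e0]; exact hC₂ t ht
  have hgb' : ∀ t ∈ Icc 0 T, ∫⁻ x, ‖g t x‖ₑ ^ 2 ≤ C₁ + C₂ := fun t ht => (hgb t ht).trans (by exact_mod_cast le_self_add)
  have hg'b' : ∀ t ∈ Icc 0 T, ∫⁻ x, ‖g' t x‖ₑ ^ 2 ≤ C₁ + C₂ := fun t ht => (hg'b t ht).trans (by exact_mod_cast le_add_self)
  have hgc : ∀ t ∈ Icc 0 T, Continuous (g t) := fun t ht =>
    continuous_cylRadius.mul (contDiff_angVortQuot (n := 0) (by exact_mod_cast (hvs t ht).of_le (by norm_cast))).continuous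
  have hgrep : ∀ t ∈ Icc 0 T, ∀ x, cylRadius x ≠ 0 → g t x = (cylRadius x ^ 2)⁻¹ * ⟪a x, vorticity v t x⟫ :=
    fun t ht x hx => hrep (hax t ht) ((hvs t ht).of_le (by norm_cast)) x hx
  have hg'rep : ∀ t ∈ Icc 0 T, ∀ x, cylRadius x ≠ 0 → g' t x = (cylRadius x ^ 2)⁻¹ * ⟪a x, curl (w t) x⟫ :=
    fun t ht x hx => hrep (hwax t ht) ((hws t ht).of_le (by norm_cast)) x hx
  -- the balance and the integrability
  have hbal := fun b (hb : b ∈ Ioc 0 T) => h.integral_sq_eq_of_repr hT hac hgrep hg'rep hgc hgb' hg'b' hb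
  have hint := h.integrableOn_integral_mul_of_repr hT hac hgrep hg'rep hgc hgb' hg'b'
  -- conversions `g² = ρΩ²`, `g g' = ρΩΩ'`
  have e1 : ∀ t, ∫ x, g t x ^ 2 = ∫ x : EuclideanSpace ℝ (Fin 3), (x 0 ^ 2 + x 1 ^ 2) * angVortQuot (v t) x ^ 2 :=
    fun t => integral_congr_ae (Eventually.of_forall fun x => by simp only [hg]; rw [mul_pow, cylRadius_sq])
  have e2 : ∀ t, ∫ x, g t x * g' t x = ∫ x : EuclideanSpace ℝ (Fin 3), (x 0 ^ 2 + x 1 ^ 2) * angVortQuot (v t) x *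
      angVortQuot (w t) x := fun t =>
    integral_congr_ae (Eventually.of_forall fun x => by simp only [hg, hg']; rw [← cylRadius_sq]; ring)
  refine ⟨?_, ?_, fun b hb => ?_⟩
  · exact hint.congr_fun (fun t _ => e2 t) measurableSet_Ioo
  · -- uniform bound from `∫ g² ≤ C₁`
    refine ⟨(C₁ : ℝ), fun t ht => ?_⟩
    have hm : MemLp (g t) 2 volume := memLp_two_of_lintegral_sq_le_coe (hgc t ht) (hgb t ht)
    rw [← e1]
    have h1 : ENNReal.ofReal (∫ x, g t x ^ 2) ≤ C₁ := by
      rw [ofReal_integral_eq_lintegral_ofReal hm.integrable_sq (Eventually.of_forall fun x => sq_nonneg _)]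
      refine (lintegral_mono fun x => ?_).trans (hgb t ht)
      rw [← ofReal_norm, Real.norm_eq_abs, ← ENNReal.ofReal_pow (abs_nonneg _), sq_abs]
    exact (ENNReal.ofReal_le_iff_le_toReal ENNReal.coe_ne_top).1 h1 |>.trans (by simp)
  · rw [← e1, ← e1, hbal b hb]
    congr 1
    rw [setIntegral_congr_fun measurableSet_Ioo fun t _ => e2 t]

/-- **`ω^θ ∈ L^∞L²` a priori** (Lei–Zhang 2017, §3, p. 9), Tao's class, `ν = 1`, axisymmetric
slices, with integrable majorants `β` of `‖vʳ/r‖_∞` and `Pm` of `∫r²Φ⁴` on `(0, T)`: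
`∫ r²Ω(b)² ≤ (∫ r²Ω(0)² + ∫₀ᵀ Pm) exp(2∫₀ᵀ β)` for `b ∈ [0, T]`. [cite: LeiZhang2017, §3, p. 9] -/
theorem IsTaoSolutionOn.omegaTheta_apriori (h : IsTaoSolutionOn T 1 u₀ v q) (hT : 0 < T)
    (hax : ∀ t ∈ Icc 0 T, IsAxisymmetric (v t))
    {β : ℝ → ℝ} (hβ0 : ∀ t, 0 ≤ β t) (hβi : IntegrableOn β (Ioo 0 T))
    (hWβ : ∀ t ∈ Ioo 0 T, ∀ x, |radVelQuot (v t) x| ≤ β t)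
    {Pm : ℝ → ℝ} (hPm0 : ∀ t ∈ Ioo 0 T, 0 ≤ Pm t) (hPmi : IntegrableOn Pm (Ioo 0 T))
    (hPle : ∀ t ∈ Ioo 0 T, ∫ x : EuclideanSpace ℝ (Fin 3), (x 0 ^ 2 + x 1 ^ 2) * angVelQuot (v t) x ^ 4 ≤ Pm t)
    {b : ℝ} (hb : b ∈ Icc 0 T) :
    ∫ x : EuclideanSpace ℝ (Fin 3), (x 0 ^ 2 + x 1 ^ 2) * angVortQuot (v b) x ^ 2 ≤
      ((∫ x : EuclideanSpace ℝ (Fin 3), (x 0 ^ 2 + x 1 ^ 2) * angVortQuot (v 0) x ^ 2) +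
        ∫ t in Ioo 0 T, Pm t) * Real.exp (2 * ∫ t in Ioo 0 T, β t) := by
  obtain ⟨hintF, ⟨Zb', hZb'⟩, hbal⟩ := h.omegaTheta_balance' hT hax
  set Z : ℝ → ℝ := fun t => ∫ x : EuclideanSpace ℝ (Fin 3), (x 0 ^ 2 + x 1 ^ 2) * angVortQuot (v t) x ^ 2 with hZ
  set F : ℝ → ℝ := fun t => ∫ x : EuclideanSpace ℝ (Fin 3), (x 0 ^ 2 + x 1 ^ 2) * angVortQuot (v t) x *
    angVortQuot (FluidPDE.timeDerivWithin (Icc 0 T) v t) x with hF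
  set KP : ℝ := ∫ t in Ioo 0 T, Pm t with hKP
  set Iβ : ℝ := ∫ t in Ioo 0 T, β t with hIβ
  have hρ0 : ∀ x : EuclideanSpace ℝ (Fin 3), 0 ≤ x 0 ^ 2 + x 1 ^ 2 := fun x => by positivity
  have hZnn : ∀ t, 0 ≤ Z t := fun t => integral_nonneg fun x => mul_nonneg (hρ0 x) (sq_nonneg _)
  have hKP0 : 0 ≤ KP := setIntegral_nonneg measurableSet_Ioo fun t ht => hPm0 t ht
  have hIβ0 : 0 ≤ Iβ := setIntegral_nonneg measurableSet_Ioo fun t _ => hβ0 t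
  -- the slice inequality on `(0, T)`
  have hslice : ∀ t ∈ Ioo 0 T, 2 * F t ≤ (2 * β t) * Z t + Pm t := by
    intro t ht
    have hs := h.omegaTheta_slice_le hT hax (Ioo_subset_Icc_self ht) (hWβ t ht)
    have := hPle t ht
    simp only [hF, hZ]
    linarith
  -- a bound of `Z` on `[0, T]`
  set Zb : ℝ := max Zb' 0 with hZbdef
  have hZm : ∀ s ∈ Icc 0 T, Z s ≤ Zb := fun s hs => (hZb' s hs).trans (le_max_left _ _)
  have hZb0 : 0 ≤ Zb := le_max_right _ _
  -- the integral inequality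
  have hκ0 : ∀ t, 0 ≤ 2 * β t := fun t => by linarith [hβ0 t]
  have hZineq : ∀ t ∈ Icc 0 T, Z t ≤ (Z 0 + KP) + (∫⁻ s in Ioo 0 t, ENNReal.ofReal (2 * β s * Z s)).toReal := by
    intro t ht
    rcases eq_or_lt_of_le ht.1 with h0 | ht0
    · rw [← h0]
      simp only [Ioo_self, Measure.restrict_empty, lintegral_zero_measure, ENNReal.toReal_zero, add_zero]
      linarith
    have hsubT : Ioo 0 t ⊆ Ioo 0 T := Ioo_subset_Ioo le_rfl ht.2
    have hbt := hbal t ⟨ht0, ht.2⟩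
    -- hbt : Z t = Z 0 + 2 ∫_{Ioo 0 t} F
    have hIoo : IntegrableOn (fun s => 2 * F s) (Ioo 0 t) volume := (hintF.mono_set hsubT).const_mul 2
    have hfinK : ∫⁻ s in Ioo 0 t, ENNReal.ofReal (2 * β s * Z s) ≠ ⊤ := by
      have imaj : IntegrableOn (fun s => 2 * β s * Zb) (Ioo 0 t) volume := ((hβi.mono_set hsubT).const_mul 2).mul_const _
      refine ne_top_of_le_ne_top (b := ∫⁻ s in Ioo 0 t, ENNReal.ofReal (2 * β s * Zb)) ?_
        (setLIntegral_mono' measurableSet_Ioo fun s hs => ENNReal.ofReal_le_ofReal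
          (mul_le_mul_of_nonneg_left (hZm s (Ioo_subset_Icc_self (hsubT hs))) (hκ0 s)))
      exact ((hasFiniteIntegral_iff_ofReal (ae_restrict_of_forall_mem measurableSet_Ioo fun s _ =>
        mul_nonneg (hκ0 s) hZb0)).1 imaj.hasFiniteIntegral).ne
    have hPmI : IntegrableOn Pm (Ioo 0 t) volume := hPmi.mono_set hsubT
    have hPmL : ∫⁻ s in Ioo 0 t, ENNReal.ofReal (Pm s) = ENNReal.ofReal (∫ s in Ioo 0 t, Pm s) :=
      (ofReal_integral_eq_lintegral_ofReal hPmI (ae_restrict_of_forall_mem measurableSet_Ioo fun s hs =>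
        hPm0 s (hsubT hs))).symm
    have hPm_meas : AEMeasurable (fun s => ENNReal.ofReal (Pm s)) (volume.restrict (Ioo 0 t)) :=
      hPmI.aestronglyMeasurable.aemeasurable.ennreal_ofReal
    have hsplit : ∫⁻ s in Ioo 0 t, ENNReal.ofReal (2 * β s * Z s + Pm s) =
        (∫⁻ s in Ioo 0 t, ENNReal.ofReal (2 * β s * Z s)) + ∫⁻ s in Ioo 0 t, ENNReal.ofReal (Pm s) := by
      rw [← lintegral_add_right' _ hPm_meas]
      refine setLIntegral_congr_fun measurableSet_Ioo fun s hs => ?_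
      exact ENNReal.ofReal_add (mul_nonneg (hκ0 s) (hZnn s)) (hPm0 s (hsubT hs))
    have hfin : ∫⁻ s in Ioo 0 t, ENNReal.ofReal (2 * β s * Z s + Pm s) ≠ ⊤ := by
      rw [hsplit, hPmL]; exact ENNReal.add_ne_top.2 ⟨hfinK, ENNReal.ofReal_ne_top⟩
    have hle1 : ∫ s in Ioo 0 t, 2 * F s ≤ (∫⁻ s in Ioo 0 t, ENNReal.ofReal (2 * β s * Z s + Pm s)).toReal :=
      integral_le_toReal_lintegral_of_le' hIoo
        (ae_restrict_of_forall_mem measurableSet_Ioo fun s hs => add_nonneg (mul_nonneg (hκ0 s) (hZnn s))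
          (hPm0 s (hsubT hs)))
        (ae_restrict_of_forall_mem measurableSet_Ioo fun s hs => hslice s (hsubT hs)) hfin
    rw [hsplit, ENNReal.toReal_add hfinK (by rw [hPmL]; exact ENNReal.ofReal_ne_top), hPmL,
      ENNReal.toReal_ofReal (setIntegral_nonneg measurableSet_Ioo fun s hs => hPm0 s (hsubT hs)),
      integral_const_mul] at hle1
    have hPmt : ∫ s in Ioo 0 t, Pm s ≤ KP :=
      setIntegral_mono_set hPmi (ae_restrict_of_forall_mem measurableSet_Ioo hPm0) (Eventually.of_forall hsubT)
    simp only [hZ, hF] at hbt hle1 ⊢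
    linarith
  -- Grönwall
  have hc : 0 ≤ Z 0 + KP := add_nonneg (hZnn 0) hKP0
  have hκfin : ∫⁻ s in Ioo 0 T, ENNReal.ofReal (2 * β s) ≠ ⊤ := by
    rw [← ofReal_integral_eq_lintegral_ofReal (hβi.const_mul 2)
      (ae_restrict_of_forall_mem measurableSet_Ioo fun s _ => hκ0 s)]
    exact ENNReal.ofReal_ne_top
  have hG := real_gronwall_Icc (a := 0) (b := T) (u := Z) (κ := fun s => 2 * β s) hc hZm (fun s _ => hκ0 s)
    hκfin hZineq
  have hexp : (∫⁻ s in Ioo 0 b, ENNReal.ofReal (2 * β s)).toReal ≤ 2 * Iβ := by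
    have h1 : ∫⁻ s in Ioo 0 b, ENNReal.ofReal (2 * β s) ≤ ∫⁻ s in Ioo 0 T, ENNReal.ofReal (2 * β s) :=
      lintegral_mono_set (Ioo_subset_Ioo le_rfl hb.2)
    have h2 : ∫⁻ s in Ioo 0 T, ENNReal.ofReal (2 * β s) = ENNReal.ofReal (2 * Iβ) := by
      rw [← ofReal_integral_eq_lintegral_ofReal (hβi.const_mul 2)
        (ae_restrict_of_forall_mem measurableSet_Ioo fun s _ => hκ0 s), integral_const_mul]
    have := ENNReal.toReal_mono ENNReal.ofReal_ne_top (h2 ▸ h1)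
    rwa [ENNReal.toReal_ofReal (by positivity)] at this
  calc Z b ≤ (Z 0 + KP) * Real.exp ((∫⁻ s in Ioo 0 b, ENNReal.ofReal (2 * β s)).toReal) := hG b hb
    _ ≤ (Z 0 + KP) * Real.exp (2 * Iβ) := mul_le_mul_of_nonneg_left (Real.exp_le_exp.2 hexp) hc

end OmegaTheta

end Literature.Analysis.FluidPDE
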